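import Literature.IUT.HodgeTheaters.GlobalFrobenioidsCosetFixedSubext
import Literature.IUT.HodgeTheaters.GlobalFrobenioidsArithmeticModel
import Literature.IUT.HodgeTheaters.Cor53iFcircHBOfBrigidKummer
import Literature.IUT.HodgeTheaters.GlobalFrobenioidsArithmeticClosers
import Literature.IUT.HodgeTheaters.GlobalFrobenioidsArithmeticCor411
import HarnessLib

/-!
# [IUTchI] Example 5.1 (i)/(iii), Corollary 5.3 (i) ⊚-slot: the PUSH carrier `ℬ(H)⁰ → ℬ(G_F)⁰` of an open homomorphism
# `ι : H → G_F` is GALOIS-RICH up to isomorphism — abc-iut-L5-t11's binder `hS` of ★ `Cor53.fcirc_rigidOverBase_of_galoisRich`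
# INHABITED at the intended induction carrier

S. Mochizuki, *Inter-universal Teichmüller theory I*, kurims manuscript (May 2020), §5 Example 5.1 (i) p. 123 l. 33–38: «a profinite
group corresponding to “C_{F_mod}” … which contains `π₁(†𝒟^⊚)` as an open subgroup; write `†𝒟^⊛` for `ℬ(−)⁰` of this profinite group,
so we obtain a natural morphism `†𝒟^⊚ → †𝒟^⊛`»; (iii) p. 125 l. 49–57: «a morphism `†𝒟^⊚ → Base(†ℱ^⊛)` which is abstractly equivalent
[cf. §0] to the natural morphism `†𝒟^⊚ → †𝒟^⊛`»; consumer locus Cor 5.3 (i) p. 144 ([IUTchI] Ex 5.1 (i) p.123)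
[claim: Mochizuki2012, status: disputed] (D-0012 claim key; nothing of the series is asserted; no side taken on [IUTchIII] Cor. 3.12).
CLASSICAL inputs (OURS): [FrdI] Ex. 6.3 p. 113 [cite: MochizukiFrdI2008, Ex. 6.3 p.113]; [FrdII] Ex. 1.3 (ii) p. 11 (the functor `φ_*`,
the tree's `CosetCat.push`) [cite: MochizukiFrdII2008, Ex 1.3 (ii) p.11].

Cell abc-iut, seat abc-iut-L5-t4 gen 9, row «HBCIRC-CARRIER» = census item (⊚-3) of abc-iut-L5-lead RULINGS #182/#185/#189, FILE B
of 2 (FILE A = `GlobalFrobenioidsCosetFixedSubext.lean`: `cosetFixedSubext F`, `G_F/V ↦ Spec F̄^V`, ≅ the chosen-base-point functor).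
DEF-LIGHT: two `abbrev` bridges (§4); everything else is a theorem; 0 instance · 0 notation · no Prop fact.  `F` perfect (number field
in §4/§5), `G_F := GalFbar F`, `H` compact totally disconnected, `ι : H →* G_F` with `Continuous ι`, `IsOpenMap ι` (injectivity unused):
* §3 for ANY `Φ : C ⥤ CosetCat H` FULL and ESSENTIALLY SURJECTIVE, `S′ := Φ ⋙ CosetCat.push ι ⋙ cosetFixedSubext F` satisfies
  abc-iut-L5-t11's clauses byte-wise (★ `GlobalDivisorData.whisker_unitsFamily_apply_eq_self_of_galoisRich`): (G1) `galoisRich_cover`,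
  (G2) `galoisRich_directed`, (G3) `galoisRich_galois` over EVERY `c₀` — all choices killed by open NORMAL subgroups of `H`;
* §4 at the PUSH CARRIER `toBase0 := baseToCoset H ⋙ CosetCat.push ι ⋙ cosetToBase G_F` («the natural morphism `†𝒟^⊚ → †𝒟^⊛`»),
  for EVERY record `𝓕 : GlobalFrobenioid (arith F) (BaseCat H) toBase0`: **`GlobalFrobenioid.exists_galoisRich_of_pushCarrier`** =
  t11's `hS` VERBATIM (via `𝓕.compat`, FILE A's iso, §3 with `Φ := 𝓕.α₁.functor ⋙ baseToCoset H`);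
* §5 KNIT with abc-iut-L5-t11's ★ `Cor53.fcirc_rigidOverBase_of_galoisRich` (`hS` discharged): **`Cor53.fcirc_rigidOverBase_of_pushCarrier`**
  (`hker⊚` ⟸ `{hZ : IsSlimGroup H}` only), `…_descend_injective_of_pushCarrier`, `…_descendBijective_of_pushCarrier_of_lifts`.

**Why up to isomorphism (recorded, not glossed over).**  The LITERAL whiskering `toBase0 ⋙ galoisSubextOfFinite F` is NOT provably
Galois-rich: its objects are `Spec F̄^{g_c ι(U_c) g_c⁻¹}` for `Classical`-chosen base points; every arrow in its image has its point in
`ι(H)·ι(U)/ι(U)` (`CosetCat.push` is not full when `ι(H) ≠ G_F`), so (G2) holds iff the chosen base points lie in ONE left `ι(H)`-coset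
— undecidable from the choice function (abc-iut-L5-t11 stated `hS` up to isomorphism for this reason).  HONEST TAGS: OUR carrier, OUR
binder; `F` plays print's `F_mod` (`GlobalFrobenioidsArithmeticModel.lean`); typed ≠ inhabited ≠ proved; nothing asserts abc.
-/

noncomputable section

namespace Literature.IUT.HodgeTheaters

open CategoryTheory Literature.AlgebraicGeometry.Frobenioids Literature.AnabelianGeometry.SemiGraphs
open Literature.AlgebraicGeometry.Frobenioids.QuasiTemperoid

/-! ### §3 The push carrier along an open homomorphism `ι : H → G_F` is GALOIS-RICH (clauses (G1)–(G3)) -/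

section GaloisRich

universe v u
variable {F : Type} [Field F] [PerfectField F]
  {H : Type} [Group H] [TopologicalSpace H] [IsTopologicalGroup H] [CompactSpace H] [TotallyDisconnectedSpace H]
  (ι : H →* GalFbar F) (hc : Continuous ι) (ho : IsOpenMap ι)
  {C : Type u} [Category.{v} C] (Φ : C ⥤ CosetCat H)

include hc in
/-- **Normal objects reach every element**: for `u ∈ F̄` some `Φ c = H/N`, `N` open NORMAL in `H`, has `u ∈ F̄^{ι(N)}` (`Gal(F̄/F(u))`
is open; its preimage under `ι` contains an open normal subgroup; `Φ` is essentially surjective). [cite: MochizukiFrdI2008, Ex. 6.3 p.113] -/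
theorem PushCarrier.exists_normal_obj_mem [Φ.EssSurj] (u : Fbar F) :
    ∃ c : C, ((Φ.obj c).sg : Subgroup H).Normal ∧ u ∈ ((Φ ⋙ CosetCat.push ι ho ⋙ cosetFixedSubext F).obj c).L := by
  haveI : IsGalois F (Fbar F) := {}
  haveI : FiniteDimensional F (IntermediateField.adjoin F {u}) :=
    IntermediateField.adjoin.finiteDimensional (Algebra.IsAlgebraic.isAlgebraic (R := F) u).isIntegral
  have hWo : IsOpen (((IntermediateField.adjoin F {u}).fixingSubgroup : Subgroup (GalFbar F)) : Set (GalFbar F)) :=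
    IntermediateField.fixingSubgroup_isOpen _
  -- an open normal subgroup of `H` inside `ι⁻¹ Gal(F̄/F(u))`
  obtain ⟨N, hN⟩ := ProfiniteGrp.exist_openNormalSubgroup_sub_open_nhds_of_one (hWo.preimage hc)
    (by rw [Set.mem_preimage, map_one]; exact one_mem _)
  -- an object `c` with `Φ c ≅ H/N`, hence `Φ c = H/N`
  obtain ⟨c, ⟨e⟩⟩ := Functor.EssSurj.mem_essImage (F := Φ) (⟨N.toOpenSubgroup⟩ : CosetCat H)
  have hmem : ∀ n, n ∈ (Φ.obj c).sg ↔ n ∈ N := fun n => PushCarrier.mem_sg_iff_of_iso_normal e N.isNormal' n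
  refine ⟨c, PushCarrier.normal_of_iso_normal e N.isNormal', ?_⟩
  change u ∈ IntermediateField.fixedField
    ((CosetCat.mapOpen ι ho (Φ.obj c).sg : OpenSubgroup (GalFbar F)) : Subgroup (GalFbar F))
  rw [IntermediateField.mem_fixedField_iff]
  intro w hw
  obtain ⟨n, hn, rfl⟩ := (CosetCat.mem_mapOpen ι ho).mp hw
  have hιn : ι n ∈ (IntermediateField.adjoin F {u}).fixingSubgroup := hN ((hmem n).mp hn)
  exact (IntermediateField.mem_fixingSubgroup_iff _ _).mp hιn u
    (IntermediateField.subset_adjoin F {u} (Set.mem_singleton u))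

include hc in
/-- **(G1) COVER** for `S′ := Φ ⋙ CosetCat.push ι ⋙ cosetFixedSubext F`, `Φ` essentially surjective (t11's clause (G1), byte-wise).
([IUTchI] Ex 5.1 (i) p.123) [cite: MochizukiFrdI2008, Ex. 6.3 p.113] [claim: Mochizuki2012, status: disputed] -/
theorem galoisRich_cover [Φ.EssSurj] :
    ∀ u : Fbar F, ∃ c : C, u ∈ ((Φ ⋙ CosetCat.push ι ho ⋙ cosetFixedSubext F).obj c).L := fun u => by
  obtain ⟨c, -, hu⟩ := PushCarrier.exists_normal_obj_mem ι hc ho Φ u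
  exact ⟨c, hu⟩

/-- **(G2) DIRECTED BY INCLUSIONS** — with `N` open normal inside `U₁ ∩ U₂` and `Φ c₃ = H/N`, the projections `H/N → H/Uᵢ`,
`1·N ↦ 1·Uᵢ` (lifted through the full `Φ`) go to the inclusions `F̄^{ι(Uᵢ)} ⊆ F̄^{ι(N)}` (t11's clause (G2), byte-wise).
([IUTchI] Ex 5.1 (i) p.123) [cite: MochizukiFrdI2008, Ex. 6.3 p.113] [claim: Mochizuki2012, status: disputed] -/
theorem galoisRich_directed [Φ.Full] [Φ.EssSurj] :
    ∀ c₁ c₂ : C, ∃ (c₃ : C) (g₁ : c₃ ⟶ c₁) (g₂ : c₃ ⟶ c₂),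
      (∀ y : ((Φ ⋙ CosetCat.push ι ho ⋙ cosetFixedSubext F).obj c₁).L,
        ((((Φ ⋙ CosetCat.push ι ho ⋙ cosetFixedSubext F).map g₁).toAlgHom y :
          ((Φ ⋙ CosetCat.push ι ho ⋙ cosetFixedSubext F).obj c₃).L) : Fbar F) = y) ∧
      (∀ y : ((Φ ⋙ CosetCat.push ι ho ⋙ cosetFixedSubext F).obj c₂).L,
        ((((Φ ⋙ CosetCat.push ι ho ⋙ cosetFixedSubext F).map g₂).toAlgHom y :
          ((Φ ⋙ CosetCat.push ι ho ⋙ cosetFixedSubext F).obj c₃).L) : Fbar F) = y) := by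
  intro c₁ c₂
  -- an open normal subgroup `N ⊆ U₁ ∩ U₂` and an object `c₃` with `Φ c₃ = H/N`
  obtain ⟨N, hN⟩ := ProfiniteGrp.exist_openNormalSubgroup_sub_open_nhds_of_one
    (((Φ.obj c₁).sg.isOpen).inter (Φ.obj c₂).sg.isOpen) ⟨one_mem _, one_mem _⟩
  obtain ⟨c₃, ⟨e⟩⟩ := Functor.EssSurj.mem_essImage (F := Φ) (⟨N.toOpenSubgroup⟩ : CosetCat H)
  have hN₃ : ∀ n, n ∈ (Φ.obj c₃).sg → n ∈ (Φ.obj c₁).sg ∧ n ∈ (Φ.obj c₂).sg := fun n hn =>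
    hN ((PushCarrier.mem_sg_iff_of_iso_normal e N.isNormal' n).mp hn)
  -- the projections `H/N → H/Uᵢ`, `1·N ↦ 1·Uᵢ`, lifted through `Φ`
  obtain ⟨g₁, hg₁⟩ := Φ.map_surjective (CosetCat.homMk ((1 : H) : (Φ.obj c₁).carrier) fun u hu =>
    (CosetCat.smul_one_eq_one_iff _ u).mpr (hN₃ u hu).1)
  obtain ⟨g₂, hg₂⟩ := Φ.map_surjective (CosetCat.homMk ((1 : H) : (Φ.obj c₂).carrier) fun u hu =>
    (CosetCat.smul_one_eq_one_iff _ u).mpr (hN₃ u hu).2)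
  have h1 : ((1 : GalFbar F) : ((CosetCat.push ι ho).obj (Φ.obj c₁)).carrier) =
      CosetCat.pt ((CosetCat.push ι ho).map (Φ.map g₁)) := by
    rw [hg₁, CosetCat.pt_push_map, CosetCat.pt_homMk, CosetCat.pushQuot_coe, map_one]
  have h2 : ((1 : GalFbar F) : ((CosetCat.push ι ho).obj (Φ.obj c₂)).carrier) =
      CosetCat.pt ((CosetCat.push ι ho).map (Φ.map g₂)) := by
    rw [hg₂, CosetCat.pt_push_map, CosetCat.pt_homMk, CosetCat.pushQuot_coe, map_one]
  refine ⟨c₃, g₁, g₂, fun y => ?_, fun y => ?_⟩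
  · have h := cosetFixedSubext_map_apply ((CosetCat.push ι ho).map (Φ.map g₁)) h1 y
    rw [AlgEquiv.one_apply] at h
    exact h
  · have h := cosetFixedSubext_map_apply ((CosetCat.push ι ho).map (Φ.map g₂)) h2 y
    rw [AlgEquiv.one_apply] at h
    exact h

include hc in
/-- **(G3) GALOIS ARROWS over `K₀ := (S′ c₀).L = F̄^{ι(U₀)}`** — `σ|_F` fixes `K₀`, so lies in `Gal(F̄/F̄^{ι(U₀)}) = ι(U₀)` (Krull;
`ι(U₀)` open hence closed), say `σ = ι(h₀)`; for `Φ c = H/N` normal with `u ∈ F̄^{ι(N)}` the morphism `H/N → H/N`, `1·N ↦ h₀·N`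
(lifted through the full `Φ`) acts on `F̄^{ι(N)}` by `ι(h₀) = σ` (t11's clause (G3), byte-wise).
([IUTchI] Ex 5.1 (i) p.123) [cite: MochizukiFrdI2008, Ex. 6.3 p.113] [claim: Mochizuki2012, status: disputed] -/
theorem galoisRich_galois [Φ.Full] [Φ.EssSurj] (c₀ : C) :
    ∀ (σ : Fbar F ≃ₐ[((Φ ⋙ CosetCat.push ι ho ⋙ cosetFixedSubext F).obj c₀).L] Fbar F) (u : Fbar F),
      ∃ (c c' : C) (g : c' ⟶ c), u ∈ ((Φ ⋙ CosetCat.push ι ho ⋙ cosetFixedSubext F).obj c).L ∧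
        ∀ y : ((Φ ⋙ CosetCat.push ι ho ⋙ cosetFixedSubext F).obj c).L,
          ((((Φ ⋙ CosetCat.push ι ho ⋙ cosetFixedSubext F).map g).toAlgHom y :
            ((Φ ⋙ CosetCat.push ι ho ⋙ cosetFixedSubext F).obj c').L) : Fbar F) = σ y := by
  intro σ u
  haveI : IsGalois F (Fbar F) := {}
  -- `σ|_F ∈ Gal(F̄/K₀) = ι(U₀)`
  have hτK : σ.restrictScalars F ∈ ((Φ ⋙ CosetCat.push ι ho ⋙ cosetFixedSubext F).obj c₀).L.fixingSubgroup :=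
    (IntermediateField.mem_fixingSubgroup_iff _ _).mpr fun x hx => by
      change σ x = x
      exact σ.commutes (⟨x, hx⟩ : ((Φ ⋙ CosetCat.push ι ho ⋙ cosetFixedSubext F).obj c₀).L)
  have hfix : ((Φ ⋙ CosetCat.push ι ho ⋙ cosetFixedSubext F).obj c₀).L.fixingSubgroup =
      ((CosetCat.mapOpen ι ho (Φ.obj c₀).sg : OpenSubgroup (GalFbar F)) : Subgroup (GalFbar F)) :=
    InfiniteGalois.fixingSubgroup_fixedField ⟨_, (CosetCat.mapOpen ι ho (Φ.obj c₀).sg).isClosed⟩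
  have hτ : σ.restrictScalars F ∈
      ((CosetCat.mapOpen ι ho (Φ.obj c₀).sg : OpenSubgroup (GalFbar F)) : Subgroup (GalFbar F)) := by
    rw [← hfix]
    exact hτK
  obtain ⟨h₀, -, hh₀⟩ := (CosetCat.mem_mapOpen ι ho).mp hτ
  -- a normal object `Φ c = H/N` whose field contains `u`
  obtain ⟨c, hnormal, hu⟩ := PushCarrier.exists_normal_obj_mem ι hc ho Φ u
  -- `H/N → H/N`, `1·N ↦ h₀·N`, lifted through `Φ`
  obtain ⟨g, hg⟩ := Φ.map_surjective
    (CosetCat.homMk ((h₀ : H) : (Φ.obj c).carrier) (PushCarrier.smul_coe_eq_of_normal _ hnormal h₀))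
  have h1 : ((σ.restrictScalars F : GalFbar F) : ((CosetCat.push ι ho).obj (Φ.obj c)).carrier) =
      CosetCat.pt ((CosetCat.push ι ho).map (Φ.map g)) := by
    rw [hg, CosetCat.pt_push_map, CosetCat.pt_homMk, CosetCat.pushQuot_coe, hh₀]
  refine ⟨c, c, g, hu, fun y => ?_⟩
  exact cosetFixedSubext_map_apply ((CosetCat.push ι ho).map (Φ.map g)) h1 y

end GaloisRich

/-! ### §4 The package at the PUSH CARRIER `ℬ(H)⁰ → ℬ(G_F)⁰` of a global Frobenioid record ([IUTchI] Ex 5.1 (iii)) -/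

section PushCarrier
/-- The bridge `ℬ(G)⁰ = ConnectedPart (BCat G) ⥤ CosetCat G` (profinite `G`): `BCat.connectedToBTemp` then the CHOSEN inverse of
`CosetCat.equivConnectedPart` (`U` = a conjugate of a point stabiliser); full and essentially surjective.
([IUTchI] Ex 5.1 (i) p.123) [cite: MochizukiFrdII2008, Ex 1.3 (i) p.11] [claim: Mochizuki2012, status: disputed] -/
abbrev baseToCoset (G : ProfiniteGrp.{0}) : BaseCat G ⥤ CosetCat G :=
  BCat.connectedToBTemp G ⋙ (CosetCat.equivConnectedPart (IsTempered.of_profinite (G := G))).inverse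

/-- The bridge `CosetCat G ⥤ ℬ(G)⁰` (profinite `G`): `CosetCat.toConnected` then the inverse of the equivalence
`BCat.connectedToBTemp` (compact `G`). ([IUTchI] Ex 5.1 (i) p.123) [cite: MochizukiFrdII2008, Ex 1.3 (i) p.11]
[claim: Mochizuki2012, status: disputed] -/
abbrev cosetToBase (G : ProfiniteGrp.{0}) : CosetCat G ⥤ BaseCat G :=
  haveI := BCat.connectedToBTemp_isEquivalence G
  CosetCat.toConnected (IsTempered.of_profinite (G := G)) ⋙ (BCat.connectedToBTemp G).inv

variable (F : Type) [Field F] [NumberField F] (H : ProfiniteGrp.{0}) (ι : H →* GalFbar F)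
  (hc : Continuous ι) (ho : IsOpenMap ι)

include hc in
/-- **[IUTchI] Ex 5.1 (i)/(iii), Cor 5.3 (i) ⊚-slot — abc-iut-L5-t11's `hS` («`S` GALOIS-RICH over `c₀`, up to isomorphism»)
INHABITED at the PUSH CARRIER** `toBase0 := baseToCoset H ⋙ CosetCat.push ι ⋙ cosetToBase G_F : ℬ(H)⁰ ⥤ ℬ(G_F)⁰` («the natural
morphism `†𝒟^⊚ → †𝒟^⊛`», `ι` continuous and open — e.g. an open embedding, `Continuous.isClosedEmbedding`): for EVERY record `𝓕` over `toBase0` ([IUTchI] Ex 5.1 (iii): `baseMor` «abstractly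
equivalent to the natural morphism») and every base object `c` (the `c₀` of the conclusion), `(baseMor ⋙ identify) ⋙ (A ↦ Spec F̄^{Stab(a_A)})`
is ISOMORPHIC to `S′ := (α₁ ⋙ baseToCoset H) ⋙ CosetCat.push ι ⋙ cosetFixedSubext F`, which satisfies (G1), (G2), (G3) (`compat`,
FILE A §2, §3).  OUR carrier / OUR binder; `F` plays print's `F_mod`. ([IUTchI] Ex 5.1 (iii) p.125) [cite: MochizukiFrdI2008, Ex. 6.3 p.113]
[claim: Mochizuki2012, status: disputed] -/
theorem GlobalFrobenioid.exists_galoisRich_of_pushCarrier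
    (𝓕 : GlobalFrobenioid (GlobalDivisorData.arith F) (BaseCat H)
      (baseToCoset H ⋙ CosetCat.push ι ho ⋙ cosetToBase (absGalGrp F)))
    (c : BaseCat H) :
    ∃ (S' : BaseCat H ⥤ FinSubextCat F (Fbar F)) (c₀ : BaseCat H)
      (_ : ((𝓕.baseMor ⋙ 𝓕.identify.functor) ⋙ galoisSubextOfFinite F) ≅ S'),
      (∀ u : Fbar F, ∃ c : BaseCat H, u ∈ (S'.obj c).L) ∧
      (∀ c₁ c₂ : BaseCat H, ∃ (c₃ : BaseCat H) (g₁ : c₃ ⟶ c₁) (g₂ : c₃ ⟶ c₂),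
        (∀ y : (S'.obj c₁).L, (((S'.map g₁).toAlgHom y : (S'.obj c₃).L) : Fbar F) = y) ∧
        (∀ y : (S'.obj c₂).L, (((S'.map g₂).toAlgHom y : (S'.obj c₃).L) : Fbar F) = y)) ∧
      (∀ (σ : Fbar F ≃ₐ[(S'.obj c₀).L] Fbar F) (u : Fbar F), ∃ (c c' : BaseCat H) (g : c' ⟶ c),
        u ∈ (S'.obj c).L ∧ ∀ y : (S'.obj c).L, (((S'.map g).toAlgHom y : (S'.obj c').L) : Fbar F) = σ y) := by
  haveI : IsGalois F (Fbar F) := isGalois_fbar F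
  haveI := BCat.connectedToBTemp_isEquivalence (absGalGrp F)
  haveI := BCat.connectedToBTemp_full H
  haveI := BCat.connectedToBTemp_essSurj H
  -- the full, essentially surjective `Φ := α₁ ⋙ bridge : ℬ(H)⁰ ⥤ CosetCat H`
  let Φ : BaseCat H ⥤ CosetCat H := 𝓕.α₁.functor ⋙ baseToCoset H
  haveI : Φ.Full := Functor.Full.comp _ _
  haveI : Φ.EssSurj := Functor.essSurj_comp _ _
  have hT : IsTempered (GalFbar F) := IsTempered.of_profinite
  obtain ⟨e₂⟩ := nonempty_toConnected_galoisSubext_iso_cosetFixedSubext F hT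
  refine ⟨Φ ⋙ CosetCat.push ι ho ⋙ cosetFixedSubext F, c, ?_, galoisRich_cover ι hc ho Φ,
    galoisRich_directed ι ho Φ, galoisRich_galois ι hc ho Φ c⟩
  -- `compat`, then the counit of `connectedToBTemp`'s equivalence, then FILE A's iso
  refine Functor.isoWhiskerRight 𝓕.compat.symm (galoisSubextOfFinite F) ≪≫ ?_
  refine (Functor.isoWhiskerLeft (Φ ⋙ CosetCat.push ι ho ⋙ CosetCat.toConnected hT)
    (Functor.isoWhiskerRight (BCat.connectedToBTemp (absGalGrp F)).asEquivalence.counitIso (galoisSubext F)) :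
      (Φ ⋙ CosetCat.push ι ho ⋙ CosetCat.toConnected hT) ⋙
          ((BCat.connectedToBTemp (absGalGrp F)).inv ⋙ BCat.connectedToBTemp (absGalGrp F)) ⋙ galoisSubext F ≅
        (Φ ⋙ CosetCat.push ι ho ⋙ CosetCat.toConnected hT) ⋙ 𝟭 _ ⋙ galoisSubext F) ≪≫ ?_
  exact Functor.isoWhiskerLeft (Φ ⋙ CosetCat.push ι ho) e₂

end PushCarrier

/-! ### §5 KNIT — `hker⊚` AT THE PUSH CARRIER with NO `hS` and NO ratio hypothesis (abc-iut-L5-t11's ★ `Cor53.fcirc_rigidOverBase_of_galoisRich`) -/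

section Knit
variable (F : Type) [Field F] [NumberField F] (H : ProfiniteGrp.{0}) (ι : H →* GalFbar F)
  (hc : Continuous ι) (ho : IsOpenMap ι)

include hc in
/-- **[IUTchI] Cor 5.3 (i) «resp. `⊚`», injectivity content AT THE PUSH CARRIER** («`π₁(†𝒟^⊚)` as an open subgroup», p. 123):
for `H` slim, EVERY self-equivalence of `†ℱ^⊚` over the identity of `†𝒟^⊚` is isomorphic to the identity — abc-iut-L5-t11's ★
`Cor53.fcirc_rigidOverBase_of_galoisRich` with `hS` DISCHARGED by §4; remaining binder `hZ : IsSlimGroup H` only.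
([IUTchI] Cor 5.3 (i) p.144) [cite: MochizukiFrdI2008, Prop. 1.6 p.27] [claim: Mochizuki2012, status: disputed] -/
theorem Cor53.fcirc_rigidOverBase_of_pushCarrier (hZ : IsSlimGroup H)
    (𝓕 : GlobalFrobenioid (GlobalDivisorData.arith F) (BaseCat H)
      (baseToCoset H ⋙ CosetCat.push ι ho ⋙ cosetToBase (absGalGrp F))) :
    CatIsomorphism.RigidOverBase 𝓕.fcircBase := by
  haveI := BCat.connectedToBTemp_essSurj H
  obtain ⟨c, -⟩ := Functor.EssSurj.mem_essImage (F := baseToCoset H) (CosetCat.top : CosetCat H)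
  exact Cor53.fcirc_rigidOverBase_of_galoisRich 𝓕 hZ (GlobalFrobenioid.exists_galoisRich_of_pushCarrier F H ι hc ho 𝓕 c)

include hc in
/-- **[IUTchI] Cor 5.3 (i) «resp. `⊚`» AT THE PUSH CARRIER: `Aut(†ℱ^⊚) → Aut(†𝒟^⊚)` is INJECTIVE** for `H` slim (t11's ★
`Cor53.fcirc_descend_injective_of_galoisRich`, `hS` discharged). ([IUTchI] Cor 5.3 (i) p.144) [cite: MochizukiFrdI2008, Prop. 1.6 p.27]
[claim: Mochizuki2012, status: disputed] -/
theorem Cor53.fcirc_descend_injective_of_pushCarrier (hZ : IsSlimGroup H)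
    (𝓕 : GlobalFrobenioid (GlobalDivisorData.arith F) (BaseCat H)
      (baseToCoset H ⋙ CosetCat.push ι ho ⋙ cosetToBase (absGalGrp F))) :
    Function.Injective (CatIsomorphism.descend
      (GlobalFrobenioid.hasUnder_and_underUnique_fcircBase_arith_baseCat 𝓕 𝓕 hZ hZ).1
      (GlobalFrobenioid.hasUnder_and_underUnique_fcircBase_arith_baseCat 𝓕 𝓕 hZ hZ).2) := by
  haveI := BCat.connectedToBTemp_essSurj H
  obtain ⟨c, -⟩ := Functor.EssSurj.mem_essImage (F := baseToCoset H) (CosetCat.top : CosetCat H)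
  exact Cor53.fcirc_descend_injective_of_galoisRich 𝓕 hZ (GlobalFrobenioid.exists_galoisRich_of_pushCarrier F H ι hc ho 𝓕 c)

end Knit

/-! ### §6 NON-VACUITY — records over a push carrier exist; at the IDENTITY carrier of `G_F` no hypothesis remains -/

section NonVacuity
variable (F : Type) [Field F] [NumberField F] (H : ProfiniteGrp.{0}) (ι : H →* GalFbar F)
  (hc : Continuous ι) (ho : IsOpenMap ι)

include hc in
/-- **Typed ≠ inhabited guard.**  Over EVERY push carrier the [IUTchI] Ex 5.1 (iii) record type is INHABITED (abc-iut-w4-d050's ★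
`nonempty_globalFrobenioid`: `†ℱ^⊛ := ℱ^⊛(†𝒟^⊚)` itself) AND every inhabitant has `hker⊚` (`H` slim) — so §5 is never about an empty
type; «bijective» modulo `hlift⊚` is the one-liner ★ `Cor53.fcirc_descendBijective_of_galoisRich_of_lifts 𝓕 hZ (exists_galoisRich_of_pushCarrier …)`.
([IUTchI] Ex 5.1 (iii) p.125) [cite: MochizukiFrdI2008, Prop. 1.6 p.27] [claim: Mochizuki2012, status: disputed] -/
theorem Cor53.nonempty_and_fcirc_rigidOverBase_of_pushCarrier (hZ : IsSlimGroup H) :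
    Nonempty (GlobalFrobenioid (GlobalDivisorData.arith F) (BaseCat H)
        (baseToCoset H ⋙ CosetCat.push ι ho ⋙ cosetToBase (absGalGrp F))) ∧
      ∀ 𝓕 : GlobalFrobenioid (GlobalDivisorData.arith F) (BaseCat H)
        (baseToCoset H ⋙ CosetCat.push ι ho ⋙ cosetToBase (absGalGrp F)), CatIsomorphism.RigidOverBase 𝓕.fcircBase :=
  ⟨nonempty_globalFrobenioid _ _ _, fun 𝓕 => Cor53.fcirc_rigidOverBase_of_pushCarrier F H ι hc ho hZ 𝓕⟩

/-- **The IDENTITY carrier of `G_F`** (`H := G_F`, `ι := id`; abc-iut-L5-t11's rider (R1) of RULINGS #182): inhabited, and `hker⊚` —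
every self-equivalence of `†ℱ^⊚` over the identity of `†𝒟^⊚` is isomorphic to the identity — for EVERY record, with NO HYPOTHESIS AT
ALL (`G_F` is slim: ★ `isSlimGroup_absGalGrp`). ([IUTchI] Cor 5.3 (i) p.144) [cite: MochizukiFrdI2008, Prop. 1.6 p.27]
[claim: Mochizuki2012, status: disputed] -/
theorem Cor53.nonempty_and_fcirc_rigidOverBase_idCarrier :
    Nonempty (GlobalFrobenioid (GlobalDivisorData.arith F) (BaseCat (absGalGrp F))
        (baseToCoset (absGalGrp F) ⋙ CosetCat.push (MonoidHom.id (GalFbar F)) IsOpenMap.id ⋙ cosetToBase (absGalGrp F))) ∧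
      ∀ 𝓕 : GlobalFrobenioid (GlobalDivisorData.arith F) (BaseCat (absGalGrp F))
        (baseToCoset (absGalGrp F) ⋙ CosetCat.push (MonoidHom.id (GalFbar F)) IsOpenMap.id ⋙ cosetToBase (absGalGrp F)),
        CatIsomorphism.RigidOverBase 𝓕.fcircBase :=
  Cor53.nonempty_and_fcirc_rigidOverBase_of_pushCarrier F (absGalGrp F) (MonoidHom.id (GalFbar F)) continuous_id
    IsOpenMap.id (isSlimGroup_absGalGrp F)

end NonVacuity

end Literature.IUT.HodgeTheaters

end
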